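import Mathlib.Analysis.SpecialFunctions.Gaussian.FourierTransform
import Mathlib.Analysis.Convolution
import Mathlib.Analysis.Distribution.TemperateGrowth
import Mathlib.MeasureTheory.Function.LpSeminorm.Basic
import Mathlib.MeasureTheory.Function.LocallyIntegrable
import Mathlib.MeasureTheory.Integral.MeanInequalities
import Mathlib.Analysis.SpecialFunctions.Pow.Real
import HarnessLib

-- provenance: harness21/H21/H21/Prelude/UnbddOp/HeatKernel.lean @ 76e3a6b (interim HEAD d8f2665); M5 mechanical rewrite
/-!
# The Gauss–Weierstrass (heat) kernel and `L^p` smoothing of `e^{tΔ}`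

Trunk: `UnbddOp` (outline §C7a). This file provides the *kernel half* of the heat semigroup
`e^{tΔ}` on a finite-dimensional real inner product space `E`:

* `Literature.heatSymbol t ξ = exp (-(2π)² t ‖ξ‖²)`, the Fourier multiplier of `e^{tΔ}` in Mathlib's
  Fourier convention (`𝓕 f ξ = ∫ exp (-2πi⟪v, ξ⟫) f v`, so that `Δ ↔ -(2π)²‖ξ‖²`);
* `Literature.heatKernel t x = (4πt)^{-n/2} exp (-‖x‖²/(4t))`, the Gauss–Weierstrass kernel;
* `Literature.heatExtension f t = heatKernel t ⋆ f`, the caloric extension `e^{tΔ} f` of a function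
  `f : E → F` with values in a **real** normed space `F` (so that it applies to real vector fields,
  as needed for mild solutions of Navier–Stokes).

together with the standard API: the semigroup law, positivity and normalisation of the kernel,
its Fourier transform, smoothness of the extension, the `L^p → L^q` smoothing estimates and strong
continuity at `t = 0`.

## Sources

* L. C. Evans, *Partial Differential Equations*, 2nd ed. (2010), §2.3.1 (fundamental solution).
* E. M. Stein, *Singular Integrals and Differentiability Properties of Functions* (1970), Ch. III §2.
* M.-H. Giga, Y. Giga, J. Saal, *Nonlinear Partial Differential Equations* (2010), §1.1
  (`L^p`–`L^q` estimates for the heat semigroup).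
* D. Applebaum, *Semigroups of Linear Operators* (2019), §3.1.1 (eq. (3.1.3)
  `γ_s ⋆ γ_t = γ_{s+t}` and Theorem 3.1.4, the semigroup property via associativity).

## Mathlib

Mathlib has Gaussian integrals (`integral_rexp_neg_mul_sq_norm`, `GaussianFourier`) and the Fourier
transform of Gaussians on inner product spaces (`fourier_gaussian_innerProductSpace`), and general
convolution (`MeasureTheory.convolution`), but no named heat kernel / heat semigroup; the three
definitions below are therefore new. Everything else (`eLpNorm`, `MemLp`, `fderiv`,
`Function.HasTemperateGrowth`, `𝓕`) is Mathlib's.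

## Design choices

* Time is a real parameter `t : ℝ`. For `t ≤ 0` the definitions still make sense formally
  (`Real.rpow` of a non-positive base and `Real.exp` of a possibly positive quadratic form give junk
  values); all API lemmas about the kernel assume `0 < t` (or `0 ≤ t` for the symbol).
* The kernel and the symbol are real-valued; where a complex-valued function is needed (Fourier
  transform) we cast pointwise.
* Constants in the smoothing estimates are existentially quantified and depend only on `E`, `p`, `q`.

## Discharges

The final section proves Young's inequality `‖K ⋆ f‖_p ≤ ‖K‖₁ ‖f‖_p` (`1 ≤ p ≤ ∞`) for the
scalar-times-vector convolution on a measurable group with a right-invariant measure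
(`Literature.Analysis.UnboundedOperators.eLpNorm_convolution_le_lintegral_enorm_mul`, Hölder + Tonelli + translation invariance), the
integrability and normalisation of the Gauss–Weierstrass kernel (via
`GaussianFourier.integral_rexp_neg_mul_sq_norm`), and from these the discharges
`integrable_heatKernel_holds`, `integral_heatKernel_eq_one_holds`, `eLpNorm_heatExtension_le_holds`
and `memLp_heatExtension_holds`; then the everywhere-existence of `L^{p'} ⋆ L^p` convolutions
(Hölder), `heatKernel t ∈ L^q` for all `1 ≤ q ≤ ∞`, the Gaussian convolution identity, and from
these the discharges `heatKernel_convolution_heatKernel_holds` and `heatExtension_add_holds`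
(via `MeasureTheory.convolution_assoc`).
-/

open MeasureTheory Filter Topology
open scoped Real ENNReal NNReal Convolution FourierTransform

noncomputable section

namespace Literature.Analysis.UnboundedOperators

/-! ### The heat symbol -/

section Symbol

variable {E : Type*} [NormedAddCommGroup E]

/-- The **heat symbol** `heatSymbol t ξ = exp (-(2π)² t ‖ξ‖²)`, i.e. the Fourier multiplier of
`e^{tΔ}` in Mathlib's normalisation of the Fourier transform (the Laplacian has symbol
`-(2π)²‖ξ‖²`). Real-valued; meaningful for `0 ≤ t`. See Stein, *Singular Integrals*, Ch. III §2. [folklore] -/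
def heatSymbol (t : ℝ) (ξ : E) : ℝ :=
  Real.exp (-(2 * π) ^ 2 * t * ‖ξ‖ ^ 2)

/-- At time `0` the heat symbol is identically `1` (`e^{0Δ} = id`). Evans, *PDE*, §2.3. [folklore] -/
@[simp]
theorem heatSymbol_zero : heatSymbol (E := E) 0 = 1 := by
  funext ξ
  simp [heatSymbol]

/-- Semigroup law for the heat symbol: `heatSymbol (s + t) = heatSymbol s * heatSymbol t`.
Evans, *PDE*, §2.3. [folklore] -/
theorem heatSymbol_add (s t : ℝ) :
    heatSymbol (E := E) (s + t) = heatSymbol s * heatSymbol t := by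
  funext ξ
  simp only [heatSymbol, Pi.mul_apply, ← Real.exp_add]
  congr 1
  ring

/-- The heat symbol is strictly positive. Stein, *Singular Integrals*, Ch. III §2. [folklore] -/
theorem heatSymbol_pos (t : ℝ) (ξ : E) : 0 < heatSymbol t ξ :=
  Real.exp_pos _

/-- For `0 ≤ t` the heat symbol is bounded by `1` (so `e^{tΔ}` is a contraction on `L²`).
Stein, *Singular Integrals*, Ch. III §2. [folklore] -/
theorem heatSymbol_le_one {t : ℝ} (ht : 0 ≤ t) (ξ : E) : heatSymbol t ξ ≤ 1 := by
  rw [heatSymbol, Real.exp_le_one_iff]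
  have : 0 ≤ (2 * π) ^ 2 * t * ‖ξ‖ ^ 2 := by positivity
  linarith

end Symbol

variable {E : Type*} [NormedAddCommGroup E] [InnerProductSpace ℝ E]

/-- On a real inner product space and for `0 ≤ t`, the heat symbol has temperate growth (there
`ξ ↦ ‖ξ‖²` is a smooth quadratic form, so `heatSymbol t` is a Schwartz function for `0 < t` and the
constant `1` for `t = 0`); hence it defines a Fourier multiplier on `𝓢` and `𝓢'`. (For a general,
non-Euclidean norm `‖·‖²` need not even be differentiable, so the inner product structure is
essential.) Stein, *Singular Integrals*, Ch. III §2. [cite: SteinSingularIntegrals1970, Ch. III §2] -/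
def heatSymbol_hasTemperateGrowth : Prop :=
  ∀ {t : ℝ} (ht : 0 ≤ t),
    Function.HasTemperateGrowth (heatSymbol (E := E) t)

/-! ### The Gauss–Weierstrass kernel -/

/-- The **Gauss–Weierstrass (heat) kernel**
`heatKernel t x = (4πt)^{-n/2} exp (-‖x‖² / (4t))`, `n = finrank ℝ E`, the fundamental solution of
the heat equation `∂ₜu = Δu`. Junk values: for `t ≤ 0` (`Real.rpow` of a non-positive base), and
for infinite-dimensional `E` (where `Module.finrank ℝ E = 0` makes the normalisation `1`); all the
API below assumes `0 < t` and `[FiniteDimensional ℝ E]`.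
Evans, *PDE*, §2.3.1. [folklore] -/
def heatKernel (t : ℝ) (x : E) : ℝ :=
  (4 * π * t) ^ (-(Module.finrank ℝ E : ℝ) / 2) * Real.exp (-‖x‖ ^ 2 / (4 * t))

/-- The heat kernel is strictly positive for `0 < t`. Evans, *PDE*, §2.3.1. [folklore] -/
theorem heatKernel_pos {t : ℝ} (ht : 0 < t) (x : E) : 0 < heatKernel t x := by
  unfold heatKernel
  positivity

variable [FiniteDimensional ℝ E] [MeasurableSpace E] [BorelSpace E]

/-- The heat kernel has total mass one: `∫ heatKernel t x dx = 1` for `0 < t`.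
Evans, *PDE*, §2.3.1, Lemma (proof via `integral_rexp_neg_mul_sq_norm`). [cite: Evans2010, §2.3.1 Lemma] -/
def integral_heatKernel_eq_one : Prop :=
  ∀ {t : ℝ} (ht : 0 < t),
    ∫ x : E, heatKernel t x = 1

/-- The heat kernel is integrable for `0 < t`. Evans, *PDE*, §2.3.1. [cite: Evans2010, §2.3.1] -/
def integrable_heatKernel : Prop :=
  ∀ {t : ℝ} (ht : 0 < t),
    Integrable (heatKernel (E := E) t)

/-- The Fourier transform of the heat kernel is the heat symbol:
`𝓕 (heatKernel t) ξ = exp (-(2π)² t ‖ξ‖²)` for `0 < t` (Mathlib's Fourier convention).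
Stein, *Singular Integrals*, Ch. III §2; proof via `fourier_gaussian_innerProductSpace`. [cite: SteinSingularIntegrals1970, Ch. III §2] -/
def fourierIntegral_heatKernel : Prop :=
  ∀ {t : ℝ} (ht : 0 < t) (ξ : E),
    𝓕 (fun x : E => (heatKernel t x : ℂ)) ξ = (heatSymbol t ξ : ℂ)

/-- Semigroup law for the kernels: `heatKernel s ⋆ heatKernel t = heatKernel (s + t)` for
`0 < s, t`. Evans, *PDE*, §2.3.1. [cite: Evans2010, §2.3.1] -/
def heatKernel_convolution_heatKernel : Prop :=
  ∀ {s t : ℝ} (hs : 0 < s) (ht : 0 < t),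
    (heatKernel (E := E) s ⋆[ContinuousLinearMap.lsmul ℝ ℝ, volume] heatKernel t) =
      heatKernel (s + t)

/-! ### The caloric extension `e^{tΔ} f` -/

variable {F : Type*} [NormedAddCommGroup F] [NormedSpace ℝ F]

/-- The **caloric (heat) extension** `heatExtension f t = heatKernel t ⋆ f = e^{tΔ} f` of a
function `f : E → F` with values in a real normed space, defined as the convolution
`x ↦ ∫ heatKernel t y • f (x - y) dy`. Junk for `t ≤ 0` and where the integral diverges.
Evans, *PDE*, §2.3.1 (formula (12)); Stein, *Singular Integrals*, Ch. III §2. [folklore] -/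
def heatExtension (f : E → F) (t : ℝ) : E → F :=
  heatKernel t ⋆[ContinuousLinearMap.lsmul ℝ ℝ, volume] f

/-- Unfolding the caloric extension as an integral: `e^{tΔ} f (x) = ∫ heatKernel t y • f (x - y) dy`.
Evans, *PDE*, §2.3.1 (12). [folklore] -/
theorem heatExtension_apply (f : E → F) (t : ℝ) (x : E) :
    heatExtension f t x = ∫ y, heatKernel t y • f (x - y) := by
  simp [heatExtension, convolution_def]

/-- The caloric extension of an `L^p` function (`1 ≤ p ≤ ∞`) is smooth in space for every `0 < t`.
Evans, *PDE*, §2.3.1, Theorem 1 (i). [cite: Evans2010, §2.3.1 Theorem 1(i)] -/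
def contDiff_heatExtension : Prop :=
  ∀ [CompleteSpace F] {f : E → F} {p : ℝ≥0∞} (hf : MemLp f p) (hp : 1 ≤ p) {t : ℝ} (ht : 0 < t),
    ContDiff ℝ (⊤ : ℕ∞) (heatExtension f t)

/-- Semigroup law `e^{tΔ} (e^{sΔ} f) = e^{(s+t)Δ} f` for `f ∈ L^p`, `1 ≤ p`, and `0 < s, t`.
The equality is stated *everywhere* (not merely a.e.): both sides are everywhere-defined absolutely
convergent integrals and agree pointwise by Fubini and `heatKernel_convolution_heatKernel`, so
consumers need not pass through `ae_eq`.
Evans, *PDE*, §2.3.1; Stein, *Singular Integrals*, Ch. III §2. [cite: Evans2010, §2.3.1] -/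
def heatExtension_add : Prop :=
  ∀ [CompleteSpace F] {f : E → F} {p : ℝ≥0∞} (hf : MemLp f p) (hp : 1 ≤ p) {s t : ℝ} (hs : 0 < s) (ht : 0 < t),
    heatExtension (heatExtension f s) t = heatExtension f (s + t)

/-- `L^p` contraction: `‖e^{tΔ} f‖_p ≤ ‖f‖_p` for `1 ≤ p ≤ ∞` and `0 < t` (Young's inequality and
`‖heatKernel t‖₁ = 1`). Giga–Giga–Saal, *Nonlinear PDEs*, §1.1.2. [cite: GigaGigaSaal2010, §1.1.2] -/
def eLpNorm_heatExtension_le : Prop :=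
  ∀ [CompleteSpace F] {f : E → F} {p : ℝ≥0∞} (hf : MemLp f p) (hp : 1 ≤ p) {t : ℝ} (ht : 0 < t),
    eLpNorm (heatExtension f t) p volume ≤ eLpNorm f p volume

/-- The caloric extension of an `L^p` function is in `L^p`, `1 ≤ p ≤ ∞`, `0 < t`.
Giga–Giga–Saal, *Nonlinear PDEs*, §1.1.2. [cite: GigaGigaSaal2010, §1.1.2] -/
def memLp_heatExtension : Prop :=
  ∀ [CompleteSpace F] {f : E → F} {p : ℝ≥0∞} (hf : MemLp f p) (hp : 1 ≤ p) {t : ℝ} (ht : 0 < t),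
    MemLp (heatExtension f t) p

variable (E F) in
/-- `L^p → L^q` smoothing estimate: there is a constant `C = C(E, p, q)` such that
`‖e^{tΔ} f‖_q ≤ C t^{-(n/2)(1/p - 1/q)} ‖f‖_p` for all `0 < t`, `1 ≤ p ≤ q ≤ ∞`, `n = finrank ℝ E`
(with `1/∞ = 0`, realised by `ENNReal.toReal`). Giga–Giga–Saal, *Nonlinear PDEs*, §1.1.3. [cite: GigaGigaSaal2010, §1.1.3] -/
def eLpNorm_heatExtension_le_rpow : Prop :=
  ∀ [CompleteSpace F] {p q : ℝ≥0∞} (hp : 1 ≤ p) (hpq : p ≤ q),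
    ∃ C : ℝ≥0, ∀ (f : E → F), MemLp f p → ∀ t : ℝ, 0 < t →
      eLpNorm (heatExtension f t) q volume ≤
        C * ENNReal.ofReal
          (t ^ (-((Module.finrank ℝ E : ℝ) / 2) * ((1 / p).toReal - (1 / q).toReal))) *
          eLpNorm f p volume

variable (E F) in
/-- Gradient estimate: there is a constant `C = C(E, p)` such that
`‖∇ e^{tΔ} f‖_p ≤ C t^{-1/2} ‖f‖_p` for all `0 < t`, `1 ≤ p ≤ ∞`.
Giga–Giga–Saal, *Nonlinear PDEs*, §1.1.3. [cite: GigaGigaSaal2010, §1.1.3] -/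
def eLpNorm_fderiv_heatExtension_le : Prop :=
  ∀ [CompleteSpace F] {p : ℝ≥0∞} (hp : 1 ≤ p),
    ∃ C : ℝ≥0, ∀ (f : E → F), MemLp f p → ∀ t : ℝ, 0 < t →
      eLpNorm (fderiv ℝ (heatExtension f t)) p volume ≤
        C * ENNReal.ofReal (t ^ (-(1 / 2 : ℝ))) * eLpNorm f p volume

/-- Strong continuity at `t = 0`: for `f ∈ L^p`, `1 ≤ p < ∞`, `‖e^{tΔ} f - f‖_p → 0` as `t → 0⁺`.
Stein, *Singular Integrals*, Ch. III §2, Theorem 2; Evans, *PDE*, §2.3.1, Theorem 1 (iii). [cite: SteinSingularIntegrals1970, Ch. III §2 Theorem 2] -/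
def tendsto_heatExtension_nhdsWithin_zero : Prop :=
  ∀ [CompleteSpace F] {f : E → F} {p : ℝ≥0∞} (hf : MemLp f p) (hp : 1 ≤ p) (hp' : p ≠ ∞),
    Tendsto (fun t : ℝ => eLpNorm (heatExtension f t - f) p volume) (𝓝[>] 0) (𝓝 0)

end Literature.Analysis.UnboundedOperators

/-! ## Proofs: Young's inequality and discharges of the kernel facts -/

namespace Literature.Analysis.UnboundedOperators

/-! ### Young's inequality `L¹ × Lᵖ → Lᵖ` -/

section HolderStep

variable {α : Type*} [MeasurableSpace α] {μ : Measure α}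

/-- Jensen/Hölder step in Young's inequality: for `1 ≤ p` and nonnegative measurable `K`, `F`,
`(∫ K F)^p ≤ (∫ K)^(p-1) ∫ K F^p`. [folklore] -/
theorem lintegral_mul_rpow_le_of_one_le {K F : α → ℝ≥0∞} (hK : AEMeasurable K μ)
    (hF : AEMeasurable F μ) {p : ℝ} (hp : 1 ≤ p) :
    (∫⁻ a, K a * F a ∂μ) ^ p ≤ (∫⁻ a, K a ∂μ) ^ (p - 1) * ∫⁻ a, K a * F a ^ p ∂μ := by
  rcases hp.eq_or_lt with rfl | hp1
  · simp
  set q := Real.conjExponent p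
  have hpq : p.HolderConjugate q := .conjExponent hp1
  have hp0 : 0 < p := hpq.pos
  -- Hölder with `K^{1/p} F` and `K^{1/q}`
  have key := ENNReal.lintegral_mul_le_Lp_mul_Lq μ hpq
    ((hK.pow_const _).mul hF : AEMeasurable (fun a => K a ^ (1 / p) * F a) μ)
    (hK.pow_const _ : AEMeasurable (fun a => K a ^ (1 / q)) μ)
  have h1 : ∀ a, K a ^ (1 / p) * F a * K a ^ (1 / q) = K a * F a := fun a => by
    rw [mul_right_comm, ← ENNReal.rpow_add_of_nonneg _ _ hpq.one_div_nonneg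
      hpq.symm.one_div_nonneg, one_div, one_div, hpq.inv_add_inv_eq_one, ENNReal.rpow_one]
  have h2 : ∀ a, (K a ^ (1 / p) * F a) ^ p = K a * F a ^ p := fun a => by
    rw [ENNReal.mul_rpow_of_nonneg _ _ hp0.le, ← ENNReal.rpow_mul, one_div_mul_cancel hp0.ne',
      ENNReal.rpow_one]
  have h3 : ∀ a, (K a ^ (1 / q)) ^ q = K a := fun a => by
    rw [← ENNReal.rpow_mul, one_div_mul_cancel hpq.symm.ne_zero, ENNReal.rpow_one]
  simp only [Pi.mul_apply, h1, h2, h3] at key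
  calc (∫⁻ a, K a * F a ∂μ) ^ p
      ≤ ((∫⁻ a, K a * F a ^ p ∂μ) ^ (1 / p) * (∫⁻ a, K a ∂μ) ^ (1 / q)) ^ p :=
        ENNReal.rpow_le_rpow key hp0.le
    _ = (∫⁻ a, K a ∂μ) ^ (p - 1) * ∫⁻ a, K a * F a ^ p ∂μ := by
        rw [ENNReal.mul_rpow_of_nonneg _ _ hp0.le, ← ENNReal.rpow_mul, ← ENNReal.rpow_mul,
          one_div_mul_cancel hp0.ne', ENNReal.rpow_one, mul_comm, one_div_mul_eq_div,
          hpq.div_conj_eq_sub_one]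

end HolderStep

section Young

variable {G : Type*} [MeasurableSpace G] [AddGroup G] {μ : Measure G}
  {F : Type*} [NormedAddCommGroup F] [NormedSpace ℝ F]

/-- Pointwise bound `‖(K ⋆ f) x‖ ≤ ∫ |K y| ‖f (x - y)‖ dy` (in `ℝ≥0∞`, unconditionally). [folklore] -/
theorem enorm_convolution_lsmul_le (K : G → ℝ) (f : G → F) (x : G) :
    ‖(K ⋆[ContinuousLinearMap.lsmul ℝ ℝ, μ] f) x‖ₑ ≤ ∫⁻ y, ‖K y‖ₑ * ‖f (x - y)‖ₑ ∂μ := by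
  rw [convolution_def]
  refine (enorm_integral_le_lintegral_enorm _).trans_eq ?_
  simp_rw [ContinuousLinearMap.lsmul_apply, enorm_smul]

variable [MeasurableAdd₂ G] [MeasurableNeg G] [SFinite μ] [μ.IsAddRightInvariant]

/-- Young's inequality `L¹ × Lᵖ → Lᵖ`, `1 ≤ p < ∞`, in `lintegral` form:
`∫ ‖K ⋆ f‖^p ≤ (∫ |K|)^p ∫ ‖f‖^p`. [folklore] -/
theorem lintegral_rpow_enorm_convolution_le {K : G → ℝ} (hK : AEStronglyMeasurable K μ)
    {f : G → F} (hf : AEStronglyMeasurable f μ) {p : ℝ} (hp : 1 ≤ p) :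
    ∫⁻ x, ‖(K ⋆[ContinuousLinearMap.lsmul ℝ ℝ, μ] f) x‖ₑ ^ p ∂μ ≤
      (∫⁻ y, ‖K y‖ₑ ∂μ) ^ p * ∫⁻ x, ‖f x‖ₑ ^ p ∂μ := by
  have hp0 : 0 < p := one_pos.trans_le hp
  set A := ∫⁻ y, ‖K y‖ₑ ∂μ with hA
  have hKm : AEMeasurable (fun y => ‖K y‖ₑ) μ := hK.enorm
  have hfm2 : AEMeasurable (fun z : G × G => ‖f (z.1 - z.2)‖ₑ ^ p) (μ.prod μ) :=
    (hf.comp_quasiMeasurePreserving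
      (quasiMeasurePreserving_sub_of_right_invariant μ μ)).enorm.pow_const _
  have hfm1 : ∀ x, AEMeasurable (fun y => ‖f (x - y)‖ₑ) μ := fun x =>
    (hf.comp_quasiMeasurePreserving
      (quasiMeasurePreserving_sub_left_of_right_invariant μ x)).enorm
  have hfm3 : ∀ y, AEMeasurable (fun x => ‖f (x - y)‖ₑ ^ p) μ := fun y =>
    (hf.comp_quasiMeasurePreserving
      (measurePreserving_sub_right μ y).quasiMeasurePreserving).enorm.pow_const _
  have hG : AEMeasurable (fun z : G × G => ‖K z.2‖ₑ * ‖f (z.1 - z.2)‖ₑ ^ p) (μ.prod μ) :=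
    hKm.comp_snd.mul hfm2
  calc ∫⁻ x, ‖(K ⋆[ContinuousLinearMap.lsmul ℝ ℝ, μ] f) x‖ₑ ^ p ∂μ
      ≤ ∫⁻ x, (∫⁻ y, ‖K y‖ₑ * ‖f (x - y)‖ₑ ∂μ) ^ p ∂μ :=
        lintegral_mono fun x =>
          ENNReal.rpow_le_rpow (enorm_convolution_lsmul_le K f x) hp0.le
    _ ≤ ∫⁻ x, A ^ (p - 1) * ∫⁻ y, ‖K y‖ₑ * ‖f (x - y)‖ₑ ^ p ∂μ ∂μ :=
        lintegral_mono fun x => lintegral_mul_rpow_le_of_one_le hKm (hfm1 x) hp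
    _ = A ^ (p - 1) * ∫⁻ y, ∫⁻ x, ‖K y‖ₑ * ‖f (x - y)‖ₑ ^ p ∂μ ∂μ := by
        rw [lintegral_const_mul'' _ hG.lintegral_prod_right', lintegral_lintegral_swap hG]
    _ = A ^ (p - 1) * ∫⁻ y, ‖K y‖ₑ * ∫⁻ x, ‖f x‖ₑ ^ p ∂μ ∂μ := by
        congr 1
        refine lintegral_congr fun y => ?_
        rw [lintegral_const_mul'' _ (hfm3 y), lintegral_sub_right_eq_self (fun x => ‖f x‖ₑ ^ p) y]
    _ = A ^ p * ∫⁻ x, ‖f x‖ₑ ^ p ∂μ := by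
        rw [lintegral_mul_const'' _ hKm, ← mul_assoc, ← hA]
        congr 1
        conv_rhs => rw [← sub_add_cancel p 1, ENNReal.rpow_add_of_nonneg _ _ (by linarith)
          zero_le_one, ENNReal.rpow_one]

/-- Young's inequality `L¹ × L^∞ → L^∞`: `‖K ⋆ f‖_∞ ≤ ‖K‖₁ ‖f‖_∞`. [folklore] -/
theorem eLpNormEssSup_convolution_le {K : G → ℝ} (hK : AEStronglyMeasurable K μ) (f : G → F) :
    eLpNormEssSup (K ⋆[ContinuousLinearMap.lsmul ℝ ℝ, μ] f) μ ≤
      (∫⁻ y, ‖K y‖ₑ ∂μ) * eLpNormEssSup f μ := by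
  refine eLpNormEssSup_le_of_ae_enorm_bound (Eventually.of_forall fun x => ?_)
  refine (enorm_convolution_lsmul_le K f x).trans ?_
  calc ∫⁻ y, ‖K y‖ₑ * ‖f (x - y)‖ₑ ∂μ ≤ ∫⁻ y, ‖K y‖ₑ * eLpNormEssSup f μ ∂μ := by
        apply lintegral_mono_ae
        filter_upwards [(quasiMeasurePreserving_sub_left_of_right_invariant μ x).ae
          (enorm_ae_le_eLpNormEssSup f μ)] with y hy
        gcongr
    _ = (∫⁻ y, ‖K y‖ₑ ∂μ) * eLpNormEssSup f μ := lintegral_mul_const'' _ hK.enorm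

/-- **Young's inequality** `L¹ × Lᵖ → Lᵖ` for the scalar-times-vector convolution:
`‖K ⋆ f‖_p ≤ ‖K‖₁ ‖f‖_p` for `1 ≤ p ≤ ∞`. [folklore] -/
theorem eLpNorm_convolution_le_lintegral_enorm_mul {K : G → ℝ} (hK : AEStronglyMeasurable K μ)
    {f : G → F} (hf : AEStronglyMeasurable f μ) {p : ℝ≥0∞} (hp : 1 ≤ p) :
    eLpNorm (K ⋆[ContinuousLinearMap.lsmul ℝ ℝ, μ] f) p μ ≤ (∫⁻ y, ‖K y‖ₑ ∂μ) * eLpNorm f p μ := by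
  rcases eq_or_ne p ∞ with rfl | hptop
  · simpa using eLpNormEssSup_convolution_le hK f
  have hp0 : p ≠ 0 := (zero_lt_one.trans_le hp).ne'
  have hp' : 1 ≤ p.toReal := by
    simpa using (ENNReal.toReal_le_toReal ENNReal.one_ne_top hptop).2 hp
  have hp0' : 0 < p.toReal := one_pos.trans_le hp'
  rw [eLpNorm_eq_lintegral_rpow_enorm_toReal hp0 hptop,
    eLpNorm_eq_lintegral_rpow_enorm_toReal hp0 hptop]
  calc (∫⁻ x, ‖(K ⋆[ContinuousLinearMap.lsmul ℝ ℝ, μ] f) x‖ₑ ^ p.toReal ∂μ) ^ (1 / p.toReal)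
      ≤ ((∫⁻ y, ‖K y‖ₑ ∂μ) ^ p.toReal * ∫⁻ x, ‖f x‖ₑ ^ p.toReal ∂μ) ^ (1 / p.toReal) :=
        ENNReal.rpow_le_rpow (lintegral_rpow_enorm_convolution_le hK hf hp')
          (by positivity)
    _ = (∫⁻ y, ‖K y‖ₑ ∂μ) * (∫⁻ x, ‖f x‖ₑ ^ p.toReal ∂μ) ^ (1 / p.toReal) := by
        rw [ENNReal.mul_rpow_of_nonneg _ _ (by positivity), ← ENNReal.rpow_mul,
          mul_one_div_cancel hp0'.ne', ENNReal.rpow_one]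

/-- The convolution of an integrable scalar kernel with an `Lᵖ` function, `1 ≤ p ≤ ∞`, is in
`Lᵖ` (Young). [folklore] -/
theorem memLp_convolution_lsmul {K : G → ℝ} (hK : Integrable K μ) {f : G → F} {p : ℝ≥0∞}
    (hf : MemLp f p μ) (hp : 1 ≤ p) : MemLp (K ⋆[ContinuousLinearMap.lsmul ℝ ℝ, μ] f) p μ := by
  refine ⟨(hK.aestronglyMeasurable.convolution_integrand (ContinuousLinearMap.lsmul ℝ ℝ)
    hf.aestronglyMeasurable).integral_prod_right', ?_⟩
  refine (eLpNorm_convolution_le_lintegral_enorm_mul hK.aestronglyMeasurable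
    hf.aestronglyMeasurable hp).trans_lt ?_
  exact ENNReal.mul_lt_top hK.hasFiniteIntegral hf.eLpNorm_lt_top

end Young

/-! ### Discharges for the Gauss–Weierstrass kernel -/

section Heat

variable {E : Type*} [NormedAddCommGroup E] [InnerProductSpace ℝ E]

/-- The heat kernel is continuous in space. [folklore] -/
theorem continuous_heatKernel (t : ℝ) : Continuous (heatKernel (E := E) t) := by
  unfold heatKernel; fun_prop

/-- The heat kernel as constant times `exp (-b ‖x‖²)` with `b = 1/(4t)`. [folklore] -/
theorem heatKernel_eq (t : ℝ) (x : E) : heatKernel t x =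
    (4 * π * t) ^ (-(Module.finrank ℝ E : ℝ) / 2) * Real.exp (-(1 / (4 * t)) * ‖x‖ ^ 2) := by
  simp only [heatKernel]
  congr 2
  ring

variable [FiniteDimensional ℝ E] [MeasurableSpace E] [BorelSpace E]

/-- Discharge of `integrable_heatKernel`. Evans, *PDE*, §2.3.1. [cite: Evans2010, §2.3.1] -/
theorem integrable_heatKernel_holds : integrable_heatKernel (E := E) := by
  intro t ht
  have hb : 0 < 1 / (4 * t) := by positivity
  have hint : Integrable (fun x : E => Real.exp (-(1 / (4 * t)) * ‖x‖ ^ 2)) := by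
    by_contra h
    have h1 := GaussianFourier.integral_rexp_neg_mul_sq_norm (V := E) hb
    rw [integral_undef h] at h1
    have : 0 < (π / (1 / (4 * t))) ^ ((Module.finrank ℝ E : ℝ) / 2) := by positivity
    exact this.ne h1
  have : heatKernel (E := E) t = fun x =>
      (4 * π * t) ^ (-(Module.finrank ℝ E : ℝ) / 2) * Real.exp (-(1 / (4 * t)) * ‖x‖ ^ 2) :=
    funext (heatKernel_eq t)
  rw [this]
  exact hint.const_mul _

/-- Discharge of `integral_heatKernel_eq_one`. Evans, *PDE*, §2.3.1, Lemma.
[cite: Evans2010, §2.3.1 Lemma] -/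
theorem integral_heatKernel_eq_one_holds : integral_heatKernel_eq_one (E := E) := by
  intro t ht
  have hb : 0 < 1 / (4 * t) := by positivity
  have h1 := GaussianFourier.integral_rexp_neg_mul_sq_norm (V := E) hb
  simp_rw [heatKernel_eq, integral_const_mul, h1]
  have h4 : π / (1 / (4 * t)) = 4 * π * t := by field_simp
  rw [h4, neg_div, Real.rpow_neg (by positivity), inv_mul_cancel₀]
  exact (Real.rpow_pos_of_pos (by positivity) _).ne'

/-- `‖heatKernel t‖₁ = 1` in `ℝ≥0∞` form. [folklore] -/
theorem lintegral_enorm_heatKernel {t : ℝ} (ht : 0 < t) :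
    ∫⁻ x, ‖heatKernel (E := E) t x‖ₑ = 1 := by
  rw [← ofReal_integral_norm_eq_lintegral_enorm (integrable_heatKernel_holds ht)]
  have : ∀ x : E, ‖heatKernel t x‖ = heatKernel t x := fun x =>
    Real.norm_of_nonneg (heatKernel_pos ht x).le
  simp_rw [this, integral_heatKernel_eq_one_holds ht, ENNReal.ofReal_one]

variable {F : Type*} [NormedAddCommGroup F] [NormedSpace ℝ F]

/-- Discharge of `eLpNorm_heatExtension_le` (Young + `‖heatKernel t‖₁ = 1`).
Giga–Giga–Saal, *Nonlinear PDEs*, §1.1.2. [cite: GigaGigaSaal2010, §1.1.2] -/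
theorem eLpNorm_heatExtension_le_holds : eLpNorm_heatExtension_le (E := E) (F := F) := by
  intro _ f p hf hp t ht
  simpa [heatExtension, lintegral_enorm_heatKernel ht] using
    eLpNorm_convolution_le_lintegral_enorm_mul (μ := volume)
      (continuous_heatKernel t).aestronglyMeasurable hf.aestronglyMeasurable hp

/-- Discharge of `memLp_heatExtension` (Young's inequality `L¹ × Lᵖ → Lᵖ` with the integrable
Gauss–Weierstrass kernel). Giga–Giga–Saal, *Nonlinear PDEs*, §1.1.2. [cite: GigaGigaSaal2010, §1.1.2] -/
theorem memLp_heatExtension_holds : memLp_heatExtension (E := E) (F := F) := by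
  intro _ f p hf hp t ht
  exact memLp_convolution_lsmul (integrable_heatKernel_holds ht) hf hp

end Heat

/-! ### Discharge of the semigroup laws

The kernels form a convolution semigroup (`heatKernel_convolution_heatKernel_holds`, a Gaussian
integral after completing the square), and `e^{tΔ} e^{sΔ} f = e^{(s+t)Δ} f` for `f ∈ L^p`
(`heatExtension_add_holds`) then follows from the associativity of convolution
(`MeasureTheory.convolution_assoc`), whose absolute-convergence hypotheses hold *everywhere*
because the Gauss–Weierstrass kernel lies in every `L^q` (`memLp_heatKernel`) and
`L^{p'} ⋆ L^p` convolutions converge at every point by Hölder's inequality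
(`convolutionExistsAt_of_memLp`). Source architecture: Applebaum, *Semigroups of Linear
Operators* (2019), §3.1.1, eq. (3.1.3) `γ_s ⋆ γ_t = γ_{s+t}` and Theorem 3.1.4 (p. 48:
`T_s T_t f = (f ⋆ γ_t) ⋆ γ_s = f ⋆ (γ_t ⋆ γ_s) = f ⋆ γ_{s+t}`, there for `f ∈ C₀`); Stein,
*Singular Integrals*, Ch. III §2 (semigroup property of the Gauss–Weierstrass integral via
`ĥ_{t₁} ĥ_{t₂} = ĥ_{t₁+t₂}`); Evans, *PDE*, §2.3.1 (the kernel `Φ`). Here the kernel identity is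
proved directly in physical space (Applebaum: "not difficult to prove directly"). -/

section HolderExists

variable {G : Type*} [MeasurableSpace G] [AddGroup G] [MeasurableAdd₂ G] [MeasurableNeg G]
  {μ : Measure G} [μ.IsAddLeftInvariant] [μ.IsNegInvariant]
  {F : Type*} [NormedAddCommGroup F] [NormedSpace ℝ F]

/-- Hölder: for real `K ∈ L^q(μ)` and `g ∈ L^p(μ)` with `1/p + 1/q = 1`, `y ↦ K y * g (x - y)`
is integrable for every `x`, i.e. the convolution `K ⋆ g` exists at *every* point (not merely
a.e.). [folklore] -/
theorem convolutionExistsAt_mul_of_memLp {K g : G → ℝ} {p q : ℝ≥0∞} [p.HolderConjugate q]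
    (hK : MemLp K q μ) (hg : MemLp g p μ) (x : G) :
    ConvolutionExistsAt K g x (ContinuousLinearMap.mul ℝ ℝ) μ := by
  have hgx : MemLp (fun y => g (x - y)) p μ :=
    hg.comp_measurePreserving (Measure.measurePreserving_sub_left μ x)
  have h : MemLp (fun y => K y * g (x - y)) 1 μ := hgx.mul' hK
  rw [memLp_one_iff_integrable] at h
  simpa [ConvolutionExistsAt] using h

/-- Hölder: for real `K ∈ L^q(μ)` and `f ∈ L^p(μ; F)` with `1/p + 1/q = 1`, the convolution
`K ⋆[L] f` exists at *every* point, for any continuous bilinear `L`. [folklore] -/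
theorem convolutionExistsAt_of_memLp [SFinite μ] [μ.IsAddRightInvariant]
    {F' : Type*} [NormedAddCommGroup F'] [NormedSpace ℝ F']
    (L : ℝ →L[ℝ] F →L[ℝ] F') {K : G → ℝ} {f : G → F} {p q : ℝ≥0∞} [p.HolderConjugate q]
    (hK : MemLp K q μ) (hf : MemLp f p μ) (x : G) :
    ConvolutionExistsAt K f x L μ :=
  (convolutionExistsAt_mul_of_memLp hK.norm hf.norm x).of_norm L hK.aestronglyMeasurable
    hf.aestronglyMeasurable

end HolderExists

section HeatSemigroup

variable {E : Type*} [NormedAddCommGroup E] [InnerProductSpace ℝ E]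

/-- The heat kernel is bounded by its value at the origin, `heatKernel t x ≤ (4πt)^{-n/2}`
(`0 < t`). [folklore] -/
theorem heatKernel_le {t : ℝ} (ht : 0 < t) (x : E) :
    heatKernel t x ≤ (4 * π * t) ^ (-(Module.finrank ℝ E : ℝ) / 2) := by
  unfold heatKernel
  refine mul_le_of_le_one_right (by positivity) ?_
  rw [Real.exp_le_one_iff, neg_div]
  have : 0 ≤ ‖x‖ ^ 2 / (4 * t) := by positivity
  linarith

/-- Completing the square for two Gaussian exponents:
`a‖y‖² + b‖x - y‖² = (ab/(a+b))‖x‖² + (a+b)‖y - (b/(a+b))•x‖²` for `a + b ≠ 0`. [folklore] -/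
theorem mul_sq_norm_add_mul_sq_norm_sub {a b : ℝ} (hab : a + b ≠ 0) (x y : E) :
    a * ‖y‖ ^ 2 + b * ‖x - y‖ ^ 2 =
      a * b / (a + b) * ‖x‖ ^ 2 + (a + b) * ‖y - (b / (a + b)) • x‖ ^ 2 := by
  rw [norm_sub_sq_real, norm_sub_sq_real, inner_smul_right, norm_smul, mul_pow,
    Real.norm_eq_abs, sq_abs, real_inner_comm x y]
  field_simp
  ring

variable [FiniteDimensional ℝ E] [MeasurableSpace E] [BorelSpace E]

/-- The heat kernel is essentially bounded, `heatKernel t ∈ L^∞` (`0 < t`). [folklore] -/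
theorem memLp_top_heatKernel {t : ℝ} (ht : 0 < t) : MemLp (heatKernel (E := E) t) ∞ volume :=
  memLp_top_of_bound (continuous_heatKernel t).aestronglyMeasurable _
    (Eventually.of_forall fun x => by
      rw [Real.norm_of_nonneg (heatKernel_pos ht x).le]
      exact heatKernel_le ht x)

/-- The heat kernel lies in `L^q` for every `1 ≤ q ≤ ∞` and `0 < t` (its `q`-th power is again
a Gaussian, integrable by `GaussianFourier.integral_rexp_neg_mul_sq_norm`). [folklore] -/
theorem memLp_heatKernel {t : ℝ} (ht : 0 < t) {q : ℝ≥0∞} (hq : 1 ≤ q) :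
    MemLp (heatKernel (E := E) t) q volume := by
  rcases eq_or_ne q ∞ with rfl | hqtop
  · exact memLp_top_heatKernel ht
  have hq0 : q ≠ 0 := (zero_lt_one.trans_le hq).ne'
  have hr : 0 < q.toReal := ENNReal.toReal_pos hq0 hqtop
  rw [← integrable_norm_rpow_iff (continuous_heatKernel t).aestronglyMeasurable hq0 hqtop]
  have : ∀ x : E, ‖heatKernel t x‖ ^ q.toReal =
      ((4 * π * t) ^ (-(Module.finrank ℝ E : ℝ) / 2)) ^ q.toReal *
        Real.exp (-(q.toReal / (4 * t)) * ‖x‖ ^ 2) := by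
    intro x
    rw [Real.norm_of_nonneg (heatKernel_pos ht x).le, heatKernel,
      Real.mul_rpow (by positivity) (by positivity), ← Real.exp_mul]
    congr 2
    field_simp
  simp_rw [this]
  have hc : 0 < q.toReal / (4 * t) := by positivity
  have hint : Integrable (fun x : E => Real.exp (-(q.toReal / (4 * t)) * ‖x‖ ^ 2)) := by
    by_contra h
    have h1 := GaussianFourier.integral_rexp_neg_mul_sq_norm (V := E) hc
    rw [integral_undef h] at h1
    exact (by positivity :
      0 < (π / (q.toReal / (4 * t))) ^ ((Module.finrank ℝ E : ℝ) / 2)).ne h1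
  exact hint.const_mul _

/-- Convolution of two centred Gaussians on a finite-dimensional inner product space:
`∫ exp(-a‖y‖²) exp(-b‖x - y‖²) dy = (π/(a+b))^{n/2} exp(-(ab/(a+b))‖x‖²)` for `0 < a, b`,
`n = finrank ℝ E` (complete the square, translate, `∫ exp(-c‖y‖²) dy = (π/c)^{n/2}`).
[folklore] -/
theorem integral_rexp_neg_mul_sq_norm_mul_rexp_neg_mul_sq_norm_sub {a b : ℝ} (ha : 0 < a)
    (hb : 0 < b) (x : E) :
    ∫ y : E, Real.exp (-a * ‖y‖ ^ 2) * Real.exp (-b * ‖x - y‖ ^ 2) =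
      (π / (a + b)) ^ ((Module.finrank ℝ E : ℝ) / 2) *
        Real.exp (-(a * b / (a + b)) * ‖x‖ ^ 2) := by
  have hab : 0 < a + b := add_pos ha hb
  have h1 : ∀ y : E, Real.exp (-a * ‖y‖ ^ 2) * Real.exp (-b * ‖x - y‖ ^ 2) =
      Real.exp (-(a * b / (a + b)) * ‖x‖ ^ 2) *
        Real.exp (-(a + b) * ‖y - (b / (a + b)) • x‖ ^ 2) := by
    intro y
    rw [← Real.exp_add, ← Real.exp_add]
    congr 1
    have := mul_sq_norm_add_mul_sq_norm_sub hab.ne' x y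
    linarith
  have h2 : ∫ y : E, Real.exp (-(a + b) * ‖y - (b / (a + b)) • x‖ ^ 2) =
      ∫ y : E, Real.exp (-(a + b) * ‖y‖ ^ 2) :=
    integral_sub_right_eq_self (μ := volume) (fun y : E => Real.exp (-(a + b) * ‖y‖ ^ 2)) _
  simp_rw [h1]
  rw [integral_const_mul, h2, GaussianFourier.integral_rexp_neg_mul_sq_norm hab, mul_comm]

/-- Discharge of `heatKernel_convolution_heatKernel`: the Gauss–Weierstrass kernels form a
convolution semigroup, `heatKernel s ⋆ heatKernel t = heatKernel (s + t)` for `0 < s, t`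
(pointwise Gaussian integral; equivalently `ĥ_s ĥ_t = ĥ_{s+t}` on the Fourier side).
Evans, *PDE*, §2.3.1 (the kernel `Φ`); Applebaum, *Semigroups of Linear Operators*, §3.1.1,
eq. (3.1.3) (p. 48); Stein, *Singular Integrals*, Ch. III §2.
[cite: Evans2010, §2.3.1] [cite: Applebaum2019, §3.1.1 eq. (3.1.3) p. 48] -/
theorem heatKernel_convolution_heatKernel_holds :
    heatKernel_convolution_heatKernel (E := E) := by
  intro s t hs ht
  funext x
  rw [convolution_def]
  simp only [ContinuousLinearMap.lsmul_apply, smul_eq_mul, heatKernel_eq]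
  have h4s : (0 : ℝ) ≤ 4 * π * s := by positivity
  have h4t : (0 : ℝ) ≤ 4 * π * t := by positivity
  have hπab : (0 : ℝ) ≤ π / (1 / (4 * s) + 1 / (4 * t)) := by positivity
  calc ∫ y : E, (4 * π * s) ^ (-(Module.finrank ℝ E : ℝ) / 2) *
          Real.exp (-(1 / (4 * s)) * ‖y‖ ^ 2) *
        ((4 * π * t) ^ (-(Module.finrank ℝ E : ℝ) / 2) *
          Real.exp (-(1 / (4 * t)) * ‖x - y‖ ^ 2))
      = ∫ y : E, (4 * π * s) ^ (-(Module.finrank ℝ E : ℝ) / 2) *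
          (4 * π * t) ^ (-(Module.finrank ℝ E : ℝ) / 2) *
          (Real.exp (-(1 / (4 * s)) * ‖y‖ ^ 2) * Real.exp (-(1 / (4 * t)) * ‖x - y‖ ^ 2)) := by
        congr 1 with y
        ring
    _ = (4 * π * s) ^ (-(Module.finrank ℝ E : ℝ) / 2) *
          (4 * π * t) ^ (-(Module.finrank ℝ E : ℝ) / 2) *
          ((π / (1 / (4 * s) + 1 / (4 * t))) ^ ((Module.finrank ℝ E : ℝ) / 2) *
            Real.exp (-(1 / (4 * s) * (1 / (4 * t)) / (1 / (4 * s) + 1 / (4 * t))) *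
              ‖x‖ ^ 2)) := by
        rw [integral_const_mul,
          integral_rexp_neg_mul_sq_norm_mul_rexp_neg_mul_sq_norm_sub (by positivity)
            (by positivity)]
    _ = (4 * π * (s + t)) ^ (-(Module.finrank ℝ E : ℝ) / 2) *
          Real.exp (-(1 / (4 * (s + t))) * ‖x‖ ^ 2) := by
        have hst : 1 / (4 * s) * (1 / (4 * t)) / (1 / (4 * s) + 1 / (4 * t)) =
            1 / (4 * (s + t)) := by
          field_simp
          ring
        have hr : ((Module.finrank ℝ E : ℝ) / 2) = -(-(Module.finrank ℝ E : ℝ) / 2) := by ring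
        rw [hst, ← mul_assoc, hr, Real.rpow_neg hπab, ← Real.inv_rpow hπab,
          ← Real.mul_rpow h4s h4t, ← Real.mul_rpow (mul_nonneg h4s h4t) (inv_nonneg.2 hπab)]
        congr 2
        field_simp
        ring

variable {F : Type*} [NormedAddCommGroup F] [NormedSpace ℝ F]

/-- Discharge of `heatExtension_add`: the semigroup law `e^{tΔ} (e^{sΔ} f) = e^{(s+t)Δ} f`,
*everywhere* in space, for `f ∈ L^p`, `1 ≤ p ≤ ∞`, `0 < s, t`. Proof: associativity of
convolution (`MeasureTheory.convolution_assoc`; its hypotheses `K_t ⋆ K_s`, `|K_s| ⋆ ‖f‖` a.e.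
and `|K_t| ⋆ (|K_s| ⋆ ‖f‖)` at the point hold everywhere by Hölder, since `K ∈ L^{p'}` and
`|K_s| ⋆ ‖f‖ ∈ L^p` by Young) and the kernel semigroup law
`heatKernel_convolution_heatKernel_holds` — the computation of Applebaum, *Semigroups of Linear
Operators*, Theorem 3.1.4 (p. 48, there for `f ∈ C₀(ℝ^d)`), carried out for `f ∈ L^p`.
Evans, *PDE*, §2.3.1; Stein, *Singular Integrals*, Ch. III §2.
[cite: Evans2010, §2.3.1] [cite: Applebaum2019, §3.1.1 Thm. 3.1.4 p. 48] -/
theorem heatExtension_add_holds : heatExtension_add (E := E) (F := F) := by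
  intro _ f p hf hp s t hs ht
  haveI : p.HolderConjugate (ENNReal.conjExponent p) := .conjExponent hp
  have hq : 1 ≤ ENNReal.conjExponent p :=
    ENNReal.HolderConjugate.one_le (ENNReal.conjExponent p) p
  funext x
  simp only [heatExtension]
  rw [add_comm s t, ← heatKernel_convolution_heatKernel_holds ht hs]
  symm
  refine convolution_assoc (ContinuousLinearMap.lsmul ℝ ℝ) (ContinuousLinearMap.lsmul ℝ ℝ)
    (ContinuousLinearMap.lsmul ℝ ℝ) (ContinuousLinearMap.lsmul ℝ ℝ) (fun a b v => mul_smul a b v)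
    (continuous_heatKernel t).aestronglyMeasurable (continuous_heatKernel s).aestronglyMeasurable
    hf.aestronglyMeasurable ?_ ?_ ?_
  · -- `heatKernel t ⋆ heatKernel s` exists everywhere (`L^∞ ⋆ L^1`)
    exact Eventually.of_forall fun y => convolutionExistsAt_of_memLp (p := 1) (q := ∞) _
      (memLp_heatKernel ht le_top) (memLp_one_iff_integrable.2 (integrable_heatKernel_holds hs)) y
  · -- `|heatKernel s| ⋆ ‖f‖` exists everywhere (Hölder, `L^{p'} ⋆ L^p`)
    exact Eventually.of_forall fun y =>
      convolutionExistsAt_mul_of_memLp (memLp_heatKernel hs hq).norm hf.norm y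
  · -- `|heatKernel t| ⋆ (|heatKernel s| ⋆ ‖f‖)` exists at `x` (Hölder after Young)
    have hY : MemLp ((fun y => ‖heatKernel s y‖) ⋆[ContinuousLinearMap.lsmul ℝ ℝ, volume]
        fun y => ‖f y‖) p volume :=
      memLp_convolution_lsmul (integrable_heatKernel_holds hs).norm hf.norm hp
    exact convolutionExistsAt_mul_of_memLp (memLp_heatKernel ht hq).norm hY x

end HeatSemigroup

end Literature.Analysis.UnboundedOperators
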